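import Mathlib
import HarnessLib
import Summits.NavierStokesRegularity.NavierStokesRegularity.Theorems.HalfSpaceWindowDoorCirculationCarryingRigidityDefs
import Summits.NavierStokesRegularity.NavierStokesRegularity.Theorems.HalfSpaceWindowDoorCirculationCarryingRigidityReduction
import Summits.NavierStokesRegularity.NavierStokesRegularity.Theorems.HalfSpaceWindowDoorCirculationCarryingRigidityCriticalStretchingAnalytic
import Summits.NavierStokesRegularity.NavierStokesRegularity.Theorems.HalfSpaceWindowDoorCirculationCarryingRigidityWindowedFlux
import Literature.Analysis.UnboundedOperators.HeatKernelBoundedData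
import Literature.Analysis.FluidPDE.AxisymNoSwirlVorticity
import Summits.NavierStokesRegularity.NavierStokesRegularity.Theorems.HalfSpaceWindowDoorCirculationCarryingRigidityPlaneFluxDynamics
import Summits.NavierStokesRegularity.NavierStokesRegularity.Theorems.HalfSpaceWindowDoorCirculationCarryingRigidityTiltingIdentity
import Summits.NavierStokesRegularity.NavierStokesRegularity.Theorems.HalfSpaceWindowDoorCirculationCarryingRigidityTiltingFlux
import Literature.Analysis.UnboundedOperators.HeatKernelHeatEquation
import Literature.Analysis.UnboundedOperators.HeatFlowCalculus
import Literature.Analysis.UnboundedOperators.HeatExtensionHarnack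
import Literature.Analysis.UnboundedOperators.HeatKernelGradient
import Literature.Analysis.UnboundedOperators.HeatKernelReversePoincare
import Literature.Analysis.FluidPDE.AxisymNoSwirlImpulseSlice
import Literature.Analysis.FluidPDE.AxisymHouLiVariables
import Literature.Analysis.Calculus.IicRpowTails
import Literature.Analysis.FluidPDE.ConstantinFeffermanStretching
import Summits.NavierStokesRegularity.NavierStokesRegularity.Theorems.PoloidalWindowDoorPoloidalWindowRigidityScrewKinematics
import Summits.NavierStokesRegularity.NavierStokesRegularity.Theorems.HalfSpaceWindowDoorCirculationCarryingRigidityGaussKernel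

/-!
# Route `HalfSpaceWindowDoor`, crux `CirculationCarryingRigidity` (stmt-NavierStokesRegularity-25311) — line «gauss-swirl»,
# part `GaussCirculation`: obligation **O3** `gaussianBound_holds` (far-past boundedness `|𝒢| ≤ B` from the Type-I rate and the first Gaussian
moment), obligation **O2** `gaussianCirculation_holds` (Gaussian Kelvin–Stokes `∫G_t(x−x₀)·g[V] = 2t·∫G_t(x−x₀)·(curl V)₂`,
`integral_G_angMom_eq`; positivity; `𝒢 = 0 ⇒ ω₃(s,·) ≡ 0`) and STEIN'S IDENTITY along a divergence-free field for linear-growth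
observables (`integral_G_inner_mul_eq`: `∫G⟪y,V⟫φ = 2t∫G·Dφ[V]`)

LINE «gauss-swirl» = ideator ns-idea-4 g11 (D-0145, files-only; critic of record idea-crit-3: PASS, grade new-combination on the wall W6
`…Defs.HemisphereLiouvilleE3`), file of record `pub/ideators/ns-idea-4/lines/gauss-swirl/GaussSwirl_v1_4.lean` (sha16 9f36760ac8cb3b0a,
`lean check` rc 0, sorries 1 = the research statement K1 only), card `LINE-gauss-swirl_v1_4.md`, PORT-MAP.md 5a0f471fb69fa47f.  PORTED
INTO THE TREE by the LEAD of 25311 (ns-hsw-p1 g6, cell pub-ns-dss) as census support `--supports stmt-NavierStokesRegularity-25311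
--as helper`: the proof texts below are the ideator's, VERBATIM modulo the split into ≤ 400-line modules, the `E3 ↦ EuclideanSpace ℝ
(Fin 3)` spelling, the namespace, added one-line docstrings and two `_`-renamings for the unused-variable linter; the vocabulary
(`InDoorClass`, `SignE3`, `gauss`, `angMom`, `gaussAngMom` = 𝒢, `gaussInflow` = ℐ, and the obligation / stratum Props) lives in
`…CirculationCarryingRigidityDefs`.

THE LINE IN ONE PARAGRAPH.  2D one-signed vorticity has the exact law `d/dt∫|x|²ω = 4νΦ`, which alone kills ancient flows with `Φ > 0`;
in the 3D closed hemisphere (`ω₃ ≥ 0`) it survives for the GAUSSIAN AXIAL ANGULAR MOMENTUM `𝒢(t;x₀) = t^{-3/2}∫e^{−|x−x₀|²/4t} g`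
(`= 2t^{-1/2}∫e^{…}ω₃ ≥ 0`), because against the divergence-free Gaussian swirl field `K_t(x−x₀)·e₃×(x−x₀)` pressure AND vortex tilting
drop out exactly, leaving ONE signed residue, the inflow correlation `ℐ = t^{-3/2}∫e^{…}((x−x₀)·v) g`: `d𝒢/ds = −𝒢/(s₀−s) − ℐ/(2(s₀−s))`;
with the time-only Type-I rate `𝒢/(s₀−s) → 0` in the far past, so «no inflow about ONE space–time axis before some epoch ⇒ poloidal».

WHAT THIS IS NOT: not a statement about Navier–Stokes regularity (Clay A).  The door statements are regularity CRITERIA about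
HYPOTHETICAL blow-up profiles (KNSS ancient mild solutions); the research statement K1 `PersistentAxis` (⟺ the wall) is NOT proved,
NOT registered and nothing is closed by this file; item 25311 stays OPEN at its research stub.
-/

noncomputable section

-- the summit and its single sub-problem share the name (CONVENTIONS §1), as in every Theorems file
set_option linter.dupNamespace false

namespace Summit.NavierStokesRegularity.NavierStokesRegularity.Theorems.HalfSpaceWindowDoorCirculationCarryingRigidityGaussCirculation


open scoped BigOperators Topology MeasureTheory InnerProductSpace RealInnerProductSpace Laplacian ContDiff
open Filter Set Function MeasureTheory Metric
open Literature.Analysis Literature.Analysis.FluidPDE Literature.Analysis.UnboundedOperators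
open Summit.NavierStokesRegularity.NavierStokesRegularity.Theses.HalfSpaceWindowDoor
open Summit.NavierStokesRegularity.NavierStokesRegularity.Theorems.HalfSpaceWindowDoorCirculationCarryingRigidityDefs
open Summit.NavierStokesRegularity.NavierStokesRegularity.Theorems.HalfSpaceWindowDoorCirculationCarryingRigidityReduction
  (circulationCarryingRigidity_of_hemisphereLiouvilleE3)
open Summit.NavierStokesRegularity.NavierStokesRegularity.Theorems.HalfSpaceWindowDoorCirculationCarryingRigidityCriticalStretchingAnalytic
  (inner_curl_e3_eq_zero_of_far_past)
open Summit.NavierStokesRegularity.NavierStokesRegularity.Theorems.LocalSineTubeDoorProfileAlignedWindowRigidityAncient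
  (bdd_of_hasTypeITimeDecay analyticOnNhd_slice)
open Summit.NavierStokesRegularity.NavierStokesRegularity.Theorems.PoloidalWindowDoorPoloidalWindowRigidityClassSpaceTimeRates
  (exists_fderiv_rate_of_class' exists_iteratedFDeriv_two_rate_of_class' exists_iteratedFDeriv_three_rate_of_class)
open Summit.NavierStokesRegularity.NavierStokesRegularity.Theorems.HalfSpaceWindowDoorCirculationCarryingRigidityPlaneFluxDynamics
  (hasDerivAt_inner_curl_e3_convect)
open Summit.NavierStokesRegularity.NavierStokesRegularity.Theorems.HalfSpaceWindowDoorCirculationCarryingRigidityTiltingIdentity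
  (convect_sub_stretch_two_eq_divh)
open Summit.NavierStokesRegularity.NavierStokesRegularity.Theorems.HalfSpaceWindowDoorCirculationCarryingRigidityTiltingFlux
  (contDiff_flux norm_flux_le norm_fderiv_flux_le)
open Summit.NavierStokesRegularity.NavierStokesRegularity.Theorems.HalfSpaceWindowDoorCirculationCarryingRigiditySubcriticalStretching
  (hasDerivAt_inner_curl_e3 fderiv_inner_e3_apply laplacian_inner_e3)
open Summit.NavierStokesRegularity.NavierStokesRegularity.Theorems.HalfSpaceWindowDoorCirculationCarryingRigidityPlaneFluxHeightWindow
  (abs_inner_e3_le contDiff_one_curl)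
open Summit.NavierStokesRegularity.NavierStokesRegularity.Theorems.HalfSpaceWindowDoorCirculationCarryingRigidityPlaneLaplacian
  (contDiff_two_curl norm_iteratedFDeriv_two_inner_e3_le)
open Summit.NavierStokesRegularity.NavierStokesRegularity.Theorems.ChiralWindowDoorClassDerivDecay (exists_classical_of_class)
open Summit.NavierStokesRegularity.NavierStokesRegularity.Theorems.PoloidalWindowDoorPoloidalWindowRigidityScrewKinematics (inner_eq_three)
open Summit.NavierStokesRegularity.NavierStokesRegularity.Theorems.HalfSpaceWindowDoorCirculationCarryingRigidityGaussKernel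

/-- **O3 PROVED (v1.1).** Far-past boundedness of the Gaussian angular momentum along a characteristic. -/
theorem gaussianBound_holds : GaussianBound := by
  intro C v hv x₀ s₀
  obtain ⟨hrate, -, -, -⟩ := hv
  refine ⟨(4 * Real.pi) ^ ((3 : ℝ) / 2) * (2 * |C|) * (2 * (2 : ℝ) ^ ((3 : ℝ) / 2)) * Real.sqrt 2,
    -(|s₀| + 1), ?_, ?_, ?_⟩
  · have := abs_nonneg s₀; linarith
  · have := neg_abs_le s₀; linarith
  intro s hs
  have hs0 : 0 < -s := by have := abs_nonneg s₀; linarith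
  have hslt : s < 0 := by linarith
  have ht : 0 < s₀ - s := by have := neg_abs_le s₀; linarith
  have ht2 : s₀ - s ≤ 2 * (-s) := by have := le_abs_self s₀; linarith
  set t := s₀ - s with ht_def
  -- the constant in front of the first Gaussian moment
  set K : ℝ := (4 * Real.pi * t) ^ ((3 : ℝ) / 2) * (2 * |C| / Real.sqrt (-s)) with hK_def
  have hK0 : 0 ≤ K := by positivity
  -- pointwise domination of the integrand
  have hpt : ∀ x, ‖gauss t x₀ x * angMom x₀ (v s) x‖ ≤ K * (heatKernel t (x - x₀) * ‖x - x₀‖) := by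
    intro x
    have hG : 0 ≤ heatKernel t (x - x₀) := (heatKernel_pos ht _).le
    have hv' : ‖v s x‖ ≤ |C| / Real.sqrt (-s) :=
      (hrate s hslt x).trans (by gcongr; exact le_abs_self C)
    have hg : |angMom x₀ (v s) x| ≤ 2 * ‖x - x₀‖ * (|C| / Real.sqrt (-s)) :=
      (abs_angMom_le x₀ (v s) x).trans (by gcongr)
    rw [Real.norm_eq_abs, abs_mul, gauss_eq_heatKernel ht,
      abs_of_nonneg (mul_nonneg (by positivity) hG)]
    calc (4 * Real.pi * t) ^ ((3 : ℝ) / 2) * heatKernel t (x - x₀) * |angMom x₀ (v s) x|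
        ≤ (4 * Real.pi * t) ^ ((3 : ℝ) / 2) * heatKernel t (x - x₀) * (2 * ‖x - x₀‖ * (|C| / Real.sqrt (-s))) :=
          mul_le_mul_of_nonneg_left hg (mul_nonneg (by positivity) hG)
      _ = K * (heatKernel t (x - x₀) * ‖x - x₀‖) := by rw [hK_def]; ring
  -- the dominating function is integrable (first absolute Gaussian moment, translated)
  have hint : Integrable (fun x : (EuclideanSpace ℝ (Fin 3)) => K * (heatKernel t (x - x₀) * ‖x - x₀‖)) :=
    (((integrable_heatKernel_mul_norm (E := (EuclideanSpace ℝ (Fin 3))) ht).comp_sub_right x₀).const_mul K)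
  have hI : ‖∫ x, gauss t x₀ x * angMom x₀ (v s) x‖ ≤ ∫ x : (EuclideanSpace ℝ (Fin 3)), K * (heatKernel t (x - x₀) * ‖x - x₀‖) :=
    norm_integral_le_of_norm_le hint (Eventually.of_forall hpt)
  have hmom : ∫ x : (EuclideanSpace ℝ (Fin 3)), K * (heatKernel t (x - x₀) * ‖x - x₀‖) = K * ∫ y : (EuclideanSpace ℝ (Fin 3)), heatKernel t y * ‖y‖ := by
    rw [integral_const_mul]
    congr 1
    exact integral_sub_right_eq_self (fun y : (EuclideanSpace ℝ (Fin 3)) => heatKernel t y * ‖y‖) x₀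
  have hmom_le : ∫ y : (EuclideanSpace ℝ (Fin 3)), heatKernel t y * ‖y‖ ≤ 2 * (2 : ℝ) ^ ((3 : ℝ) / 2) * t ^ (1 / 2 : ℝ) := by
    have h := integral_heatKernel_mul_norm_le (E := (EuclideanSpace ℝ (Fin 3))) ht
    rw [finrank_euclideanSpace_fin] at h
    norm_num at h ⊢
    exact h
  -- assemble
  unfold gaussAngMom
  rw [abs_mul, abs_of_nonneg (Real.rpow_nonneg ht.le _)]
  rw [Real.norm_eq_abs] at hI
  calc t ^ (-(3 : ℝ) / 2) * |∫ x, gauss t x₀ x * angMom x₀ (v s) x|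
      ≤ t ^ (-(3 : ℝ) / 2) * (K * (2 * (2 : ℝ) ^ ((3 : ℝ) / 2) * t ^ (1 / 2 : ℝ))) := by
        apply mul_le_mul_of_nonneg_left _ (Real.rpow_nonneg ht.le _)
        exact (hI.trans_eq hmom).trans (mul_le_mul_of_nonneg_left hmom_le hK0)
    _ = (t ^ (-(3 : ℝ) / 2) * (4 * Real.pi * t) ^ ((3 : ℝ) / 2)) * (2 * |C|) * (2 * (2 : ℝ) ^ ((3 : ℝ) / 2))
          * (t ^ (1 / 2 : ℝ) / Real.sqrt (-s)) := by rw [hK_def]; ring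
    _ = (4 * Real.pi) ^ ((3 : ℝ) / 2) * (2 * |C|) * (2 * (2 : ℝ) ^ ((3 : ℝ) / 2))
          * (t ^ (1 / 2 : ℝ) / Real.sqrt (-s)) := by rw [rpow_scale ht]
    _ ≤ (4 * Real.pi) ^ ((3 : ℝ) / 2) * (2 * |C|) * (2 * (2 : ℝ) ^ ((3 : ℝ) / 2)) * Real.sqrt 2 :=
        mul_le_mul_of_nonneg_left (sqrt_ratio_le ht hs0 ht2) (by positivity)

/-- **Gaussian Kelvin–Stokes identity** for a `C¹` field with bounded values and gradient:
`∫ G_t(x−x₀) g = 2t ∫ G_t(x−x₀) ω₃`. -/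
theorem integral_G_angMom_eq {V : (EuclideanSpace ℝ (Fin 3)) → (EuclideanSpace ℝ (Fin 3))} (hV : Differentiable ℝ V) (hVc : Continuous (fderiv ℝ V)) {B M : ℝ}
    (hB : ∀ x, ‖V x‖ ≤ B) (hM : ∀ x, ‖fderiv ℝ V x‖ ≤ M) {t : ℝ} (ht : 0 < t) (x₀ : (EuclideanSpace ℝ (Fin 3))) :
    ∫ x, heatKernel t (x - x₀) * angMom x₀ V x = (2 * t) * ∫ x, heatKernel t (x - x₀) * curl V x 2 := by
  set f : Fin 3 → (EuclideanSpace ℝ (Fin 3)) → ℝ := fun i y => V y i with hf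
  set G : (EuclideanSpace ℝ (Fin 3)) → ℝ := fun y => heatKernel t (y - x₀) with hG
  have hf_diff : ∀ i, Differentiable ℝ (f i) := fun i => differentiable_apply3 hV i
  have hf_cont : ∀ i, Continuous (f i) := fun i => continuous_apply3 hV.continuous i
  have hf_bdd : ∀ i y, ‖f i y‖ ≤ B := fun i y => (Real.norm_eq_abs _).le.trans ((abs_apply3_le i y).trans (hB _))
  have hDf_cont : ∀ i j, Continuous (fun y => fderiv ℝ (f i) y (EuclideanSpace.single j 1)) :=
    fun i j => continuous_fderiv_apply3 hV hVc i _
  have hDf_bdd : ∀ i j y, ‖fderiv ℝ (f i) y (EuclideanSpace.single j 1)‖ ≤ M := fun i j y =>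
    (Real.norm_eq_abs _).le.trans ((abs_fderiv_apply3_le hV i j y).trans (hM _))
  have hG_int : Integrable G := integrable_G x₀ ht
  have hG_diff : Differentiable ℝ G := fun x => (hasFDerivAt_G x₀ t x).differentiableAt
  have hDGj_int : ∀ j, Integrable (fun y => fderiv ℝ G y (EuclideanSpace.single j 1)) :=
    fun j => integrable_fderiv_G_apply x₀ ht j
  have I1 : ∀ i j, Integrable (fun y => fderiv ℝ (f i) y (EuclideanSpace.single j 1) * G y) :=
    fun i j => hG_int.bdd_mul (hDf_cont i j).aestronglyMeasurable (ae_of_all _ (hDf_bdd i j))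
  have I2 : ∀ i j, Integrable (fun y => f i y * fderiv ℝ G y (EuclideanSpace.single j 1)) :=
    fun i j => (hDGj_int j).bdd_mul (hf_cont i).aestronglyMeasurable (ae_of_all _ (hf_bdd i))
  have I3 : ∀ i, Integrable (fun y => f i y * G y) :=
    fun i => hG_int.bdd_mul (hf_cont i).aestronglyMeasurable (ae_of_all _ (hf_bdd i))
  have IBP : ∀ i j, ∫ y, f i y * fderiv ℝ G y (EuclideanSpace.single j 1) =
      -∫ y, fderiv ℝ (f i) y (EuclideanSpace.single j 1) * G y := fun i j =>
    integral_mul_fderiv_eq_neg_fderiv_mul_of_integrable (μ := volume) (I1 i j) (I2 i j) (I3 i)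
      (fun y _ => hf_diff i y) (fun y _ => hG_diff y)
  -- rewrite the left integrand with `(x − x₀)ⱼ G = −2t ∂ⱼG`
  have hL : (fun x => heatKernel t (x - x₀) * angMom x₀ V x) = fun x =>
      -(2 * t) * (f 1 x * fderiv ℝ G x (EuclideanSpace.single 0 1)) -
        -(2 * t) * (f 0 x * fderiv ℝ G x (EuclideanSpace.single 1 1)) := by
    funext x
    simp only [angMom, hf, hG]
    have h0 := coord_mul_G x₀ ht.ne' x 0
    have h1 := coord_mul_G x₀ ht.ne' x 1
    calc heatKernel t (x - x₀) * ((x - x₀) 0 * V x 1 - (x - x₀) 1 * V x 0)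
        = ((x - x₀) 0 * heatKernel t (x - x₀)) * V x 1 - ((x - x₀) 1 * heatKernel t (x - x₀)) * V x 0 := by ring
      _ = _ := by rw [h0, h1]; ring
  -- and the right integrand with `ω₃ = ∂₀f₁ − ∂₁f₀`
  have hR : (fun x => heatKernel t (x - x₀) * curl V x 2) = fun x =>
      fderiv ℝ (f 1) x (EuclideanSpace.single 0 1) * G x - fderiv ℝ (f 0) x (EuclideanSpace.single 1 1) * G x := by
    funext x
    rw [curl_apply_two, hf, fderiv_apply3 hV 1, fderiv_apply3 hV 0]
    simp only [hG]; ring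
  rw [hL, hR, integral_sub ((I2 1 0).const_mul _) ((I2 0 1).const_mul _), integral_const_mul, integral_const_mul,
    IBP 1 0, IBP 0 1, integral_sub (I1 1 0) (I1 0 1)]
  ring

/-- The Gaussian vorticity integrand `G ω₃` is integrable, continuous and (closed hemisphere) non-negative. -/
theorem integrable_G_curl {V : (EuclideanSpace ℝ (Fin 3)) → (EuclideanSpace ℝ (Fin 3))} (hVω : Continuous (fun x => curl V x 2)) {M : ℝ}
    (hM : ∀ x, |curl V x 2| ≤ M) {t : ℝ} (ht : 0 < t) (x₀ : (EuclideanSpace ℝ (Fin 3))) :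
    Integrable (fun x => heatKernel t (x - x₀) * curl V x 2) := by
  have h := (integrable_G x₀ ht).bdd_mul hVω.aestronglyMeasurable (ae_of_all _ fun x => (Real.norm_eq_abs _).le.trans (hM x))
  exact h.congr (ae_of_all _ fun x => by simp [mul_comm])

/-- **O2 PROVED (v1.1).** Gaussian Kelvin–Stokes, positivity, and `𝒢 = 0 ⇒ ω₃ ≡ 0`. -/
theorem gaussianCirculation_holds : GaussianCirculation := by
  intro C v hv hsign x₀ t s ht hs
  obtain ⟨hrate, hcont, hmild, -⟩ := hv
  obtain ⟨K₁, -, hK₁⟩ := exists_fderiv_rate_of_class' hrate hcont hmild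
  have hA : AnalyticOnNhd ℝ (v s) univ := analyticOnNhd_slice hcont (bdd_of_hasTypeITimeDecay hrate) hmild hs
  have hVd : Differentiable ℝ (v s) := fun x => (hA x (mem_univ x)).differentiableAt
  have hVc : Continuous (fderiv ℝ (v s)) := continuousOn_univ.1 hA.fderiv.continuousOn
  have hB : ∀ x, ‖v s x‖ ≤ C / Real.sqrt (-s) := fun x => hrate s hs x
  have hM : ∀ x, ‖fderiv ℝ (v s) x‖ ≤ K₁ / (-s) := hK₁ s hs
  -- `ω₃` continuous, bounded, non-negative
  have hωc : Continuous (fun x => curl (v s) x 2) :=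
    continuous_apply3 (V := curl (v s)) (continuousOn_univ.1 (analyticOnNhd_curl hA).continuousOn) 2
  have hωb : ∀ x, |curl (v s) x 2| ≤ 2 * (K₁ / (-s)) := by
    intro x
    rw [curl_apply_two]
    have h1 : |fderiv ℝ (v s) x (EuclideanSpace.single 0 1) 1| ≤ K₁ / (-s) := by
      rw [← fderiv_apply3 hVd]; exact (abs_fderiv_apply3_le hVd 1 0 x).trans (hM x)
    have h2 : |fderiv ℝ (v s) x (EuclideanSpace.single 1 1) 0| ≤ K₁ / (-s) := by
      rw [← fderiv_apply3 hVd]; exact (abs_fderiv_apply3_le hVd 0 1 x).trans (hM x)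
    calc |fderiv ℝ (v s) x (EuclideanSpace.single 0 1) 1 - fderiv ℝ (v s) x (EuclideanSpace.single 1 1) 0|
        ≤ |fderiv ℝ (v s) x (EuclideanSpace.single 0 1) 1| + |fderiv ℝ (v s) x (EuclideanSpace.single 1 1) 0| := abs_sub _ _
      _ ≤ K₁ / (-s) + K₁ / (-s) := add_le_add h1 h2
      _ = 2 * (K₁ / (-s)) := by ring
  have hωnn : ∀ x, 0 ≤ curl (v s) x 2 := fun x => by rw [← inner_e3_apply]; exact hsign s hs x
  -- the identity and the sign
  have hid := integral_G_angMom_eq hVd hVc hB hM ht x₀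
  have hint := integrable_G_curl hωc hωb ht x₀
  have hnn : 0 ≤ ∫ x, heatKernel t (x - x₀) * curl (v s) x 2 :=
    integral_nonneg fun x => mul_nonneg (heatKernel_pos ht _).le (hωnn x)
  have hgauss : (fun x => gauss t x₀ x * angMom x₀ (v s) x) = fun x =>
      (4 * Real.pi * t) ^ ((3 : ℝ) / 2) * (heatKernel t (x - x₀) * angMom x₀ (v s) x) := by
    funext x; rw [gauss_eq_heatKernel ht]; ring
  have hval : gaussAngMom t x₀ (v s) =
      t ^ (-(3 : ℝ) / 2) * (4 * Real.pi * t) ^ ((3 : ℝ) / 2) * (2 * t) * ∫ x, heatKernel t (x - x₀) * curl (v s) x 2 := by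
    unfold gaussAngMom
    rw [hgauss, integral_const_mul, hid]; ring
  have hc : 0 < t ^ (-(3 : ℝ) / 2) * (4 * Real.pi * t) ^ ((3 : ℝ) / 2) * (2 * t) := by positivity
  refine ⟨by rw [hval]; exact mul_nonneg hc.le hnn, fun h0 y => ?_⟩
  -- zero Gaussian angular momentum ⇒ `∫ G ω₃ = 0` ⇒ `G ω₃ ≡ 0` ⇒ `ω₃ ≡ 0`
  rw [hval] at h0
  have hI0 : ∫ x, heatKernel t (x - x₀) * curl (v s) x 2 = 0 := by
    rcases mul_eq_zero.1 h0 with h | h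
    · exact absurd h hc.ne'
    · exact h
  have hae : (fun x => heatKernel t (x - x₀) * curl (v s) x 2) =ᵐ[volume] 0 :=
    (integral_eq_zero_iff_of_nonneg (fun x => mul_nonneg (heatKernel_pos ht _).le (hωnn x)) hint).1 hI0
  have heq : (fun x => heatKernel t (x - x₀) * curl (v s) x 2) = 0 :=
    (((continuous_G x₀ t).mul hωc).ae_eq_iff_eq volume continuous_const).1 hae
  have hy := congr_fun heq y
  simp only [Pi.zero_apply, mul_eq_zero] at hy
  rw [inner_e3_apply]
  rcases hy with h | h
  · exact absurd h (heatKernel_pos ht _).ne'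
  · exact h

/-! ### §2c (v1.2) Gaussian moments, Stein's identity along a divergence-free field, and the KINEMATIC swirl–inflow identity
`∫ G ⟪y, v⟫ g = 2t ∫ G [y₀F₀ + y₁F₁]` (O1b, PROVED) -/

section Stein
variable {V : (EuclideanSpace ℝ (Fin 3)) → (EuclideanSpace ℝ (Fin 3))} {t : ℝ} (x₀ : (EuclideanSpace ℝ (Fin 3)))

/-- **Gaussian integration by parts along a divergence-free field.**  For a bounded `C¹` divergence-free `V` with bounded
gradient and a `C¹` scalar `φ` of linear growth with linear-growth gradient:
`∫ G_t(x−x₀) ⟪x − x₀, V(x)⟫ φ(x) dx = 2t ∫ G_t(x−x₀) Dφ(x)[V(x)] dx`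
(`(x−x₀)ᵢG = −2t∂ᵢG`, one integration by parts per coordinate, `div V = 0`). -/
theorem integral_G_inner_mul_eq (hV : ContDiff ℝ 1 V) {B M : ℝ} (hB : ∀ x, ‖V x‖ ≤ B) (hM : ∀ x, ‖fderiv ℝ V x‖ ≤ M)
    (hdiv : VectorCalculus.IsDivFree V) {φ : (EuclideanSpace ℝ (Fin 3)) → ℝ} (hφ : ContDiff ℝ 1 φ) {a b a' b' : ℝ}
    (h0 : ∀ x, ‖φ x‖ ≤ a + b * ‖x - x₀‖) (h1 : ∀ x, ‖fderiv ℝ φ x‖ ≤ a' + b' * ‖x - x₀‖) (ht : 0 < t) :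
    Integrable (fun x => heatKernel t (x - x₀) * (⟪x - x₀, V x⟫_ℝ * φ x)) ∧
    Integrable (fun x => heatKernel t (x - x₀) * fderiv ℝ φ x (V x)) ∧
    ∫ x, heatKernel t (x - x₀) * (⟪x - x₀, V x⟫_ℝ * φ x) = 2 * t * ∫ x, heatKernel t (x - x₀) * fderiv ℝ φ x (V x) := by
  have hVd : Differentiable ℝ V := hV.differentiable one_ne_zero
  have hVc : Continuous V := hV.continuous
  have hφc : Continuous φ := hφ.continuous
  have hφd : Differentiable ℝ φ := hφ.differentiable one_ne_zero
  have hB0 : 0 ≤ B := (norm_nonneg _).trans (hB x₀)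
  have hM0 : 0 ≤ M := (norm_nonneg _).trans (hM x₀)
  -- ψᵢ = Vᵢ φ
  set ψ : Fin 3 → (EuclideanSpace ℝ (Fin 3)) → ℝ := fun i x => V x i * φ x with hψ
  have hψ1 : ∀ i, ContDiff ℝ 1 (ψ i) := fun i => (contDiff_apply3 hV i).mul hφ
  have hψ0 : ∀ i x, ‖ψ i x‖ ≤ B * a + B * b * ‖x - x₀‖ := by
    intro i x
    have ha : 0 ≤ a + b * ‖x - x₀‖ := (norm_nonneg _).trans (h0 x)
    calc ‖ψ i x‖ = |V x i| * ‖φ x‖ := by rw [hψ]; simp only [norm_mul, Real.norm_eq_abs]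
      _ ≤ B * (a + b * ‖x - x₀‖) := mul_le_mul ((abs_coord_le_norm_e3 _ i).trans (hB x)) (h0 x) (norm_nonneg _) hB0
      _ = B * a + B * b * ‖x - x₀‖ := by ring
  have hψD : ∀ i x, ‖fderiv ℝ (ψ i) x‖ ≤ (B * a' + a * M) + (B * b' + b * M) * ‖x - x₀‖ := by
    intro i x
    have hfd : fderiv ℝ (ψ i) x = V x i • fderiv ℝ φ x + φ x • fderiv ℝ (fun y => V y i) x := by
      rw [hψ]; exact fderiv_mul (differentiable_apply3 hVd i x) (hφd x)
    rw [hfd]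
    calc ‖V x i • fderiv ℝ φ x + φ x • fderiv ℝ (fun y => V y i) x‖
        ≤ ‖V x i • fderiv ℝ φ x‖ + ‖φ x • fderiv ℝ (fun y => V y i) x‖ := norm_add_le _ _
      _ = |V x i| * ‖fderiv ℝ φ x‖ + ‖φ x‖ * ‖fderiv ℝ (fun y => V y i) x‖ := by
          rw [norm_smul, norm_smul, Real.norm_eq_abs]
      _ ≤ B * (a' + b' * ‖x - x₀‖) + (a + b * ‖x - x₀‖) * M :=
          add_le_add (mul_le_mul ((abs_coord_le_norm_e3 _ i).trans (hB x)) (h1 x) (norm_nonneg _) hB0)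
            (mul_le_mul (h0 x) ((norm_fderiv_apply3_le hVd i x).trans (hM x)) (norm_nonneg _)
              ((norm_nonneg _).trans (h0 x)))
      _ = (B * a' + a * M) + (B * b' + b * M) * ‖x - x₀‖ := by ring
  have IBP : ∀ i, _ := fun i => integral_G_mul_fderiv_eq_lin x₀ (hψ1 i) (hψ0 i) (hψD i) ht i
  -- pointwise: the sum of ∂ᵢψᵢ is Dφ[V]
  have hsum : ∀ x, fderiv ℝ (ψ 0) x (EuclideanSpace.single 0 1) + fderiv ℝ (ψ 1) x (EuclideanSpace.single 1 1) +
      fderiv ℝ (ψ 2) x (EuclideanSpace.single 2 1) = fderiv ℝ φ x (V x) := by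
    intro x
    have hfd : ∀ i, fderiv ℝ (ψ i) x (EuclideanSpace.single i 1) =
        V x i * fderiv ℝ φ x (EuclideanSpace.single i 1) + φ x * fderiv ℝ V x (EuclideanSpace.single i 1) i := by
      intro i
      have hfd' : fderiv ℝ (ψ i) x = V x i • fderiv ℝ φ x + φ x • fderiv ℝ (fun y => V y i) x := by
        rw [hψ]; exact fderiv_mul (differentiable_apply3 hVd i x) (hφd x)
      rw [hfd']
      simp only [add_apply, smul_apply, smul_eq_mul]
      rw [fderiv_apply3 hVd]
    have hdv := hdiv x
    rw [divergence_eq_sum_three] at hdv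
    rw [hfd 0, hfd 1, hfd 2, clm_apply_eq_sum3 (fderiv ℝ φ x) (V x)]
    simp only [smul_eq_mul]
    linear_combination (φ x) * hdv
  -- pointwise: ⟪y, V⟫ G φ = −2t Σ ∂ᵢG ψᵢ
  have hptw : ∀ x, heatKernel t (x - x₀) * (⟪x - x₀, V x⟫_ℝ * φ x) =
      -(2 * t) * (fderiv ℝ (fun y : (EuclideanSpace ℝ (Fin 3)) => heatKernel t (y - x₀)) x (EuclideanSpace.single 0 1) * ψ 0 x +
        fderiv ℝ (fun y : (EuclideanSpace ℝ (Fin 3)) => heatKernel t (y - x₀)) x (EuclideanSpace.single 1 1) * ψ 1 x +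
        fderiv ℝ (fun y : (EuclideanSpace ℝ (Fin 3)) => heatKernel t (y - x₀)) x (EuclideanSpace.single 2 1) * ψ 2 x) := by
    intro x
    rw [inner_eq_three, fderiv_G_apply, fderiv_G_apply, fderiv_G_apply, hψ]
    field_simp
    ring
  obtain ⟨A0, B0, E0⟩ := IBP 0
  obtain ⟨A1, B1, E1⟩ := IBP 1
  obtain ⟨A2, B2, E2⟩ := IBP 2
  have B01 : Integrable (fun x => fderiv ℝ (fun y : (EuclideanSpace ℝ (Fin 3)) => heatKernel t (y - x₀)) x (EuclideanSpace.single 0 1) * ψ 0 x +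
      fderiv ℝ (fun y : (EuclideanSpace ℝ (Fin 3)) => heatKernel t (y - x₀)) x (EuclideanSpace.single 1 1) * ψ 1 x) := B0.add B1
  have A01 : Integrable (fun x => heatKernel t (x - x₀) * fderiv ℝ (ψ 0) x (EuclideanSpace.single 0 1) +
      heatKernel t (x - x₀) * fderiv ℝ (ψ 1) x (EuclideanSpace.single 1 1)) := A0.add A1
  have IntL : Integrable (fun x => heatKernel t (x - x₀) * (⟪x - x₀, V x⟫_ℝ * φ x)) := by
    have : (fun x => heatKernel t (x - x₀) * (⟪x - x₀, V x⟫_ℝ * φ x)) = fun x =>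
        -(2 * t) * (fderiv ℝ (fun y : (EuclideanSpace ℝ (Fin 3)) => heatKernel t (y - x₀)) x (EuclideanSpace.single 0 1) * ψ 0 x +
          fderiv ℝ (fun y : (EuclideanSpace ℝ (Fin 3)) => heatKernel t (y - x₀)) x (EuclideanSpace.single 1 1) * ψ 1 x +
          fderiv ℝ (fun y : (EuclideanSpace ℝ (Fin 3)) => heatKernel t (y - x₀)) x (EuclideanSpace.single 2 1) * ψ 2 x) := funext hptw
    rw [this]
    exact (B01.add B2).const_mul _
  have IntR : Integrable (fun x => heatKernel t (x - x₀) * fderiv ℝ φ x (V x)) := by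
    have : (fun x => heatKernel t (x - x₀) * fderiv ℝ φ x (V x)) = fun x =>
        heatKernel t (x - x₀) * fderiv ℝ (ψ 0) x (EuclideanSpace.single 0 1) +
          heatKernel t (x - x₀) * fderiv ℝ (ψ 1) x (EuclideanSpace.single 1 1) +
          heatKernel t (x - x₀) * fderiv ℝ (ψ 2) x (EuclideanSpace.single 2 1) := by
      funext x; rw [← hsum x]; ring
    rw [this]
    exact A01.add A2
  refine ⟨IntL, IntR, ?_⟩
  calc ∫ x, heatKernel t (x - x₀) * (⟪x - x₀, V x⟫_ℝ * φ x)
      = ∫ x, -(2 * t) * (fderiv ℝ (fun y : (EuclideanSpace ℝ (Fin 3)) => heatKernel t (y - x₀)) x (EuclideanSpace.single 0 1) * ψ 0 x +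
          fderiv ℝ (fun y : (EuclideanSpace ℝ (Fin 3)) => heatKernel t (y - x₀)) x (EuclideanSpace.single 1 1) * ψ 1 x +
          fderiv ℝ (fun y : (EuclideanSpace ℝ (Fin 3)) => heatKernel t (y - x₀)) x (EuclideanSpace.single 2 1) * ψ 2 x) :=
        integral_congr_ae (ae_of_all _ hptw)
    _ = -(2 * t) * ((∫ x, fderiv ℝ (fun y : (EuclideanSpace ℝ (Fin 3)) => heatKernel t (y - x₀)) x (EuclideanSpace.single 0 1) * ψ 0 x) +
          (∫ x, fderiv ℝ (fun y : (EuclideanSpace ℝ (Fin 3)) => heatKernel t (y - x₀)) x (EuclideanSpace.single 1 1) * ψ 1 x) +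
          ∫ x, fderiv ℝ (fun y : (EuclideanSpace ℝ (Fin 3)) => heatKernel t (y - x₀)) x (EuclideanSpace.single 2 1) * ψ 2 x) := by
        rw [integral_const_mul, integral_add B01 B2, integral_add B0 B1]
    _ = 2 * t * ((∫ x, heatKernel t (x - x₀) * fderiv ℝ (ψ 0) x (EuclideanSpace.single 0 1)) +
          (∫ x, heatKernel t (x - x₀) * fderiv ℝ (ψ 1) x (EuclideanSpace.single 1 1)) +
          ∫ x, heatKernel t (x - x₀) * fderiv ℝ (ψ 2) x (EuclideanSpace.single 2 1)) := by
        rw [E0, E1, E2]; ring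
    _ = 2 * t * ∫ x, heatKernel t (x - x₀) * fderiv ℝ φ x (V x) := by
        rw [← integral_add A0 A1, ← integral_add A01 A2]
        congr 1
        refine integral_congr_ae (ae_of_all _ fun x => ?_)
        show heatKernel t (x - x₀) * fderiv ℝ (ψ 0) x (EuclideanSpace.single 0 1) +
            heatKernel t (x - x₀) * fderiv ℝ (ψ 1) x (EuclideanSpace.single 1 1) +
            heatKernel t (x - x₀) * fderiv ℝ (ψ 2) x (EuclideanSpace.single 2 1) =
          heatKernel t (x - x₀) * fderiv ℝ φ x (V x)
        rw [← hsum x]; ring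

end Stein

end Summit.NavierStokesRegularity.NavierStokesRegularity.Theorems.HalfSpaceWindowDoorCirculationCarryingRigidityGaussCirculation

end
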